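import Literature.AnabelianGeometry.EtaleTheta.ThetaKummerInputOfCore
import Literature.AnabelianGeometry.EtaleTheta.EtaleThetaDataOfClass
import Literature.AnabelianGeometry.EtaleTheta.SettingModelChiKummerDataCusp
import Literature.AnabelianGeometry.EtaleTheta.Discharge.Sec1ConstCompatSchema
import HarnessLib

/-!
# [EtTh] Prop. 1.4 (iii), Kummer side: the hypotheses `ConstCompat` + "`η̈^Θ` is the Kummer class of `Θ̈`"
# are JOINTLY INHABITED with GENUINE cyclotome coefficients over every Kummer core — in particular at
# the χ-twisted root models `ThetaSetting.modelχ p` / `modelχ' p` (proof-only; NV census tokens)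

Mochizuki, *The étale theta function and its Frobenioid-theoretic manifestations*, Publ. RIMS **45**
(2009) [EtTh], §1, Prop. 1.3 p. 21 ("the composite of the Kummer map `O^×_K̈ → H¹(G_K̈, Δ_Θ)` with the
natural map …"), Prop. 1.4 (iii) p. 22 ("the set of 'Kummer classes' `⊆ H¹(Π^tp_Ÿ, Δ_Θ)` associated to the
`O^×_K̈`-multiples of `Θ̈`, regarded as a regular function on `Ÿ` … is precisely the set
`O^×_K̈ · η̈^Θ`") [cite: MochizukiEtTh2009, Prop 1.4 (iii) p.22].

Layer L2 of the abc-iut cell, seat abc-iut-w5-d125 (gen 6), NV-L2 row «ThetaKummerInput GENUINE +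
ConstCompat + Prop14iiiKummer at modelχ / modelχ′» (self-named sequel of this seat's gen-3 file
`ThetaKummerInputOfCore.lean`, promised there "the minute a Kummer core of `modelχ` lands"; abc-iut-L2-lead
RULINGS pattern «self-directed NV piece in lineage»). PROOF-ONLY companion: no `def`, no instance, no new
named fact; nothing of the cited files is edited or restated. Composition BY NAME of

* `ThetaSetting.KummerCore.exists_thetaKummerInput_constCompat` (this seat, `ThetaKummerInputOfCore.lean`):
  from ANY Kummer core `C` of a theta setting `D` and any `θ ∈ K̈^×`, a `ThetaKummerInput` (abc-iut-L2-t12,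
  `ThetaKummerClass.lean`) with BIJECTIVE coefficients `Λ(ℚ̄_p^×) ≅ Δ_Θ` (`= C.coeffHom`), "`Θ̈ := θ`",
  `ConstCompat` w.r.t. `C.toKummerData`, and `κΘ̈ = κ(θ)`, `κΘ̈ = 1 ↔ θ = 1`;
* `ThetaSetting.KummerData.etaleThetaDataOfClass` (abc-iut-L2-t6, `EtaleThetaDataOfClass.lean`): an
  `EtaleThetaData` over a given Kummer datum with a GIVEN class `η̈^Θ` (honest-degenerate `½`-groups);
* `ThetaSetting.ThetaKummerInput.prop14iiiKummer_of_etaDd_eq` / `thetaClasses_eq_kummerUnitMultiples`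
  (abc-iut-L2-t12): the discharge of Prop. 1.4 (iii)₁ under `ConstCompat` + `η̈^Θ = κΘ̈`;
* the Kummer cores `SettingModel.kummerCoreχ p` / `kummerCoreχ' p` of the χ-twisted root models
  (abc-iut-w5-d171, `SettingModelChiKummerData(Cusp).lean`; R78 cluster files F6 (c)), whose Kummer data ARE
  the named data `SettingModel.kummerDataχ p` / `kummerDataχ' p` by definition.

RESULTS (kernel):

* `KummerCore.exists_thetaKummerInput_etaleThetaData_prop14iii` — over ANY `C : D.KummerCore` and `θ ∈ K̈^×`
  there are `T : D.ThetaKummerInput`, `E : D.EtaleThetaData` with: bijective coefficients, `E.toKummerData =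
  C.toKummerData`, `T.ConstCompat E.toKummerData`, `E.etaDd = κΘ̈ = κ(θ)`, `κΘ̈ = 1 ↔ θ = 1`,
  `Prop14iiiKummer E κΘ̈`, and the theta classes `O^×_K̈ · η̈^Θ` ARE the Kummer classes of the multiples
  `c · Θ̈`, `c ∈ O^×_K̈` — i.e. EVERY hypothesis of abc-iut-L2-t12's discharge is inhabited at once, with a
  non-degenerate bridge (contrast: abc-iut-w5-d047's degenerate witness `Fn := 1`,
  `KummerLevelRecordsNonVacuity.lean`, has `κΘ̈ = κ(c) = 1` and is `ConstCompat` with NO Kummer datum,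
  `Sec1ConstCompatSchema.lean`).
* `SettingModel.kummerDataχ_exists_thetaKummerInput_constCompat` (+ `χ'`): at the NAMED datum `kummerDataχ p`
  a theta-Kummer input with bijective coefficients, `ConstCompat`, and `κΘ̈ ≠ 1` EXISTS.
* `SettingModel.kummerDataχ_constCompat_independent` (+ `χ'`): **F-0618 `ConstCompat` at the named datum has
  BOTH truth values witnessed** (positive: here; negative: `KummerData.exists_thetaKummerInput_not_constCompat`,
  abc-iut-f-117 lineage) — the predicate is a genuine condition on the pair `(T, E)`, neither vacuous nor
  automatic. Census token «ConstCompat@kummerDataχ/χ′: INDEPENDENT (both values WITNESSED)».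
* `SettingModel.kummerDataχ_exists_prop14iiiKummer_genuine` (+ `χ'`) and
  `ThetaSetting.exists_isEtThOrigin_prop14iiiKummer_genuine`: **F-0589 `Prop14iiiKummer` MODEL-WITNESSED with
  genuine coefficients at a setting satisfying the guard `IsEtThOrigin`** (`modelχ_isEtThOrigin`, abc-iut-L2-t1).

HONEST FRAMING: the χ-twisted root models are SEMI-SYNTHETIC (abc-iut-L2-t1 / R78 cluster labels) —
consistency / non-vacuity evidence for the typed [EtTh] §1 interface only; the `½`-coefficient groups of the
`EtaleThetaData` used are the honest-degenerate ones of `etaleThetaDataOfClass`; nothing of [EtTh] is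
asserted; typed ≠ proved; no side is taken on [IUTchIII] Cor. 3.12.
-/

noncomputable section

namespace Literature.AnabelianGeometry.EtaleTheta

open Literature.AnabelianGeometry.SemiGraphs

namespace ThetaSetting

variable {p : ℕ} [Fact p.Prime] {D : ThetaSetting p}

namespace KummerCore

variable (C : D.KummerCore)

/-- **Every hypothesis of the Kummer-side discharge of Prop. 1.4 (iii) is inhabited at once over a Kummer
core, with GENUINE coefficients.** For `C : D.KummerCore` and `θ ∈ K̈^×` there are a theta-Kummer input `T`
(bijective `Λ(Fn) ≅ Δ_Θ`, "`Θ̈ := θ`") and an `EtaleThetaData E` over `C.toKummerData` with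
`η̈^Θ := κΘ̈`, such that `ConstCompat`, `κΘ̈ = κ(θ)`, `κΘ̈ = 1 ↔ θ = 1`, `Prop14iiiKummer E κΘ̈`, and
the theta classes `O^×_K̈ · η̈^Θ` are exactly the Kummer classes of the multiples `c · Θ̈`, `c ∈ O^×_K̈`.
[cite: MochizukiEtTh2009, Prop 1.4 (iii) p.22] -/
theorem exists_thetaKummerInput_etaleThetaData_prop14iii (θ : (↥D.Kdd)ˣ) :
    ∃ (T : D.ThetaKummerInput) (E : D.EtaleThetaData),
      Function.Bijective T.coeff.hom ∧ E.toKummerData = C.toKummerData ∧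
      T.ConstCompat C.toKummerData ∧ E.etaDd = T.kummerTheta ∧ T.kummerTheta = T.kummerConst θ ∧
      (T.kummerTheta = 1 ↔ θ = 1) ∧ Prop14iiiKummer E T.kummerTheta ∧
      E.thetaClasses = {x | ∃ c ∈ D.unitsOKdd, x = T.kummerConstMulTheta c} := by
  obtain ⟨T, hb, hCC, hθ, hiff⟩ := C.exists_thetaKummerInput_constCompat θ
  refine ⟨T, C.toKummerData.etaleThetaDataOfClass T.kummerTheta, hb, rfl, hCC, rfl, hθ, hiff, ?_, ?_⟩
  · exact T.prop14iiiKummer_of_etaDd_eq _ rfl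
  · exact T.thetaClasses_eq_kummerUnitMultiples _ hCC ⟨1, one_mem _, (one_mul _).symm⟩

/-- In particular (take `θ := -1`; `κ(−1) ≠ 1` for any compatible input, abc-iut-f-117 lineage
`kummerConst_neg_one_ne_one_of_constCompat`): over any Kummer core the discharge hypotheses of Prop. 1.4 (iii)
are jointly inhabited with bijective coefficients and a NON-TRIVIAL Kummer class `κΘ̈ ≠ 1`.
[cite: MochizukiEtTh2009, Prop 1.4 (iii) p.22] -/
theorem exists_thetaKummerInput_etaleThetaData_prop14iii_ne_one :
    ∃ (T : D.ThetaKummerInput) (E : D.EtaleThetaData),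
      Function.Bijective T.coeff.hom ∧ E.toKummerData = C.toKummerData ∧
      T.ConstCompat C.toKummerData ∧ E.etaDd = T.kummerTheta ∧ T.kummerTheta ≠ 1 ∧
      Prop14iiiKummer E T.kummerTheta ∧
      E.thetaClasses = {x | ∃ c ∈ D.unitsOKdd, x = T.kummerConstMulTheta c} := by
  obtain ⟨T, E, hb, hE, hCC, hη, hθ, -, h14, hcl⟩ :=
    C.exists_thetaKummerInput_etaleThetaData_prop14iii (-1)
  exact ⟨T, E, hb, hE, hCC, hη,
    fun h => T.kummerConst_neg_one_ne_one_of_constCompat hCC (hθ.symm.trans h), h14, hcl⟩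

end KummerCore

variable (p) in
/-- **F-0589 `Prop14iiiKummer` / F-0618 `ConstCompat`, MODEL-WITNESSED under the guard**: there is a theta setting
over `p` satisfying `IsEtThOrigin` (the χ-twisted root model `modelχ p`, abc-iut-L2-t1) carrying a theta-Kummer
input with bijective coefficients and an `EtaleThetaData` with `ConstCompat`, `η̈^Θ = κΘ̈ ≠ 1` and
`Prop14iiiKummer`. [cite: MochizukiEtTh2009, Prop 1.4 (iii) p.22] -/
theorem exists_isEtThOrigin_prop14iiiKummer_genuine :
    ∃ D : ThetaSetting p, D.IsEtThOrigin ∧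
      ∃ (T : D.ThetaKummerInput) (E : D.EtaleThetaData),
        Function.Bijective T.coeff.hom ∧ T.ConstCompat E.toKummerData ∧ E.etaDd = T.kummerTheta ∧
        T.kummerTheta ≠ 1 ∧ Prop14iiiKummer E T.kummerTheta := by
  obtain ⟨T, E, hb, hE, hCC, hη, hne, h14, -⟩ :=
    (SettingModel.kummerCoreχ p).exists_thetaKummerInput_etaleThetaData_prop14iii_ne_one
  exact ⟨ThetaSetting.modelχ p, modelχ_isEtThOrigin p, T, E, hb, hE ▸ hCC, hη, hne, h14⟩

end ThetaSetting

/-! ### At the NAMED Kummer data of the χ-twisted root models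

(At a concrete model the pull-back action instance `T.instAction : MulDistribMulAction (modelχ p).PiTemp T.Fn`
is supplied by `letI` — instance search does not re-find it through the unfolded carrier of the model; same
device as `SettingModel.kummerDataχ_kumY`.) -/

namespace SettingModel

variable (p : ℕ) [Fact p.Prime]

/-- **At the named datum `kummerDataχ p`** (abc-iut-w5-d171): a theta-Kummer input with BIJECTIVE coefficients
`Λ(ℚ̄_p^×) ≅ Ẑ ≅ Δ_Θ(modelχ)`, `ConstCompat (kummerDataχ p)`, and non-trivial `κΘ̈` EXISTS.
[cite: MochizukiEtTh2009, Prop 1.4 (iii) p.22] -/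
theorem kummerDataχ_exists_thetaKummerInput_constCompat :
    ∃ T : (ThetaSetting.modelχ p).ThetaKummerInput,
      (letI := T.instAction; Function.Bijective T.coeff.hom) ∧ T.ConstCompat (kummerDataχ p) ∧
        T.kummerTheta ≠ 1 :=
  (kummerCoreχ p).exists_thetaKummerInput_bijective_ne_one

/-- **`ConstCompat` at `kummerDataχ p` is a genuine condition: BOTH truth values are witnessed** (positive:
the core's bridge; negative: the degenerate bridge, abc-iut-f-117 `exists_thetaKummerInput_not_constCompat`).
Census token «ConstCompat@kummerDataχ: INDEPENDENT». [cite: MochizukiEtTh2009, Prop 1.3 p.21] -/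
theorem kummerDataχ_constCompat_independent :
    (∃ T : (ThetaSetting.modelχ p).ThetaKummerInput,
        (letI := T.instAction; Function.Bijective T.coeff.hom) ∧ T.ConstCompat (kummerDataχ p)) ∧
      ∃ T : (ThetaSetting.modelχ p).ThetaKummerInput, ¬ T.ConstCompat (kummerDataχ p) := by
  obtain ⟨T, hb, hCC, -⟩ := kummerDataχ_exists_thetaKummerInput_constCompat p
  exact ⟨⟨T, hb, hCC⟩, (kummerDataχ p).exists_thetaKummerInput_not_constCompat⟩

/-- **Prop. 1.4 (iii), Kummer side, MODEL-WITNESSED with genuine coefficients at `modelχ`**: over the named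
datum `kummerDataχ p` there are `T` (bijective coefficients, `ConstCompat`) and `E : EtaleThetaData` with
`E.toKummerData = kummerDataχ p`, `η̈^Θ = κΘ̈ ≠ 1`, `Prop14iiiKummer E κΘ̈`, and the theta classes
`O^×_K̈ · η̈^Θ` equal to the Kummer classes of the `O^×_K̈`-multiples of `Θ̈`.
[cite: MochizukiEtTh2009, Prop 1.4 (iii) p.22] -/
theorem kummerDataχ_exists_prop14iiiKummer_genuine :
    ∃ (T : (ThetaSetting.modelχ p).ThetaKummerInput) (E : (ThetaSetting.modelχ p).EtaleThetaData),
      (letI := T.instAction; Function.Bijective T.coeff.hom) ∧ E.toKummerData = kummerDataχ p ∧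
      T.ConstCompat (kummerDataχ p) ∧ E.etaDd = T.kummerTheta ∧ T.kummerTheta ≠ 1 ∧
      ThetaSetting.Prop14iiiKummer E T.kummerTheta ∧
      E.thetaClasses = {x | ∃ c ∈ (ThetaSetting.modelχ p).unitsOKdd, x = T.kummerConstMulTheta c} := by
  obtain ⟨T, E, hb, hE, hCC, hη, hne, h14, hcl⟩ :=
    (kummerCoreχ p).exists_thetaKummerInput_etaleThetaData_prop14iii_ne_one
  exact ⟨T, E, hb, hE, hCC, hη, hne, h14, hcl⟩

/-- **At the named datum `kummerDataχ' p` of the CUSPED χ-model**: a theta-Kummer input with bijective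
coefficients, `ConstCompat (kummerDataχ' p)`, and `κΘ̈ ≠ 1` EXISTS.
[cite: MochizukiEtTh2009, Prop 1.4 (iii) p.22] -/
theorem kummerDataχ'_exists_thetaKummerInput_constCompat :
    ∃ T : (ThetaSetting.modelχ' p).ThetaKummerInput,
      (letI := T.instAction; Function.Bijective T.coeff.hom) ∧ T.ConstCompat (kummerDataχ' p) ∧
        T.kummerTheta ≠ 1 :=
  (kummerCoreχ' p).exists_thetaKummerInput_bijective_ne_one

/-- **`ConstCompat` at `kummerDataχ' p`: BOTH truth values witnessed** (census token
«ConstCompat@kummerDataχ′: INDEPENDENT»). [cite: MochizukiEtTh2009, Prop 1.3 p.21] -/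
theorem kummerDataχ'_constCompat_independent :
    (∃ T : (ThetaSetting.modelχ' p).ThetaKummerInput,
        (letI := T.instAction; Function.Bijective T.coeff.hom) ∧ T.ConstCompat (kummerDataχ' p)) ∧
      ∃ T : (ThetaSetting.modelχ' p).ThetaKummerInput, ¬ T.ConstCompat (kummerDataχ' p) := by
  obtain ⟨T, hb, hCC, -⟩ := kummerDataχ'_exists_thetaKummerInput_constCompat p
  exact ⟨⟨T, hb, hCC⟩, (kummerDataχ' p).exists_thetaKummerInput_not_constCompat⟩

/-- **Prop. 1.4 (iii), Kummer side, MODEL-WITNESSED with genuine coefficients at the CUSPED model `modelχ'`**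
(a setting with `IsEtThOrigin` AND a cusp, abc-iut-w5-d029). [cite: MochizukiEtTh2009, Prop 1.4 (iii) p.22] -/
theorem kummerDataχ'_exists_prop14iiiKummer_genuine :
    ∃ (T : (ThetaSetting.modelχ' p).ThetaKummerInput) (E : (ThetaSetting.modelχ' p).EtaleThetaData),
      (letI := T.instAction; Function.Bijective T.coeff.hom) ∧ E.toKummerData = kummerDataχ' p ∧
      T.ConstCompat (kummerDataχ' p) ∧ E.etaDd = T.kummerTheta ∧ T.kummerTheta ≠ 1 ∧
      ThetaSetting.Prop14iiiKummer E T.kummerTheta ∧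
      E.thetaClasses = {x | ∃ c ∈ (ThetaSetting.modelχ' p).unitsOKdd, x = T.kummerConstMulTheta c} := by
  obtain ⟨T, E, hb, hE, hCC, hη, hne, h14, hcl⟩ :=
    (kummerCoreχ' p).exists_thetaKummerInput_etaleThetaData_prop14iii_ne_one
  exact ⟨T, E, hb, hE, hCC, hη, hne, h14, hcl⟩

/-- The cusped model also satisfies the guard: `IsEtThOrigin ∧` (genuine Prop. 1.4 (iii) Kummer-side witness)
at `modelχ' p`. [cite: MochizukiEtTh2009, Prop 1.4 (iii) p.22] -/
theorem modelχ'_isEtThOrigin_and_prop14iiiKummer_genuine :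
    (ThetaSetting.modelχ' p).IsEtThOrigin ∧
      ∃ (T : (ThetaSetting.modelχ' p).ThetaKummerInput) (E : (ThetaSetting.modelχ' p).EtaleThetaData),
        (letI := T.instAction; Function.Bijective T.coeff.hom) ∧ T.ConstCompat E.toKummerData ∧
        E.etaDd = T.kummerTheta ∧ T.kummerTheta ≠ 1 ∧ ThetaSetting.Prop14iiiKummer E T.kummerTheta := by
  obtain ⟨T, E, hb, hE, hCC, hη, hne, h14, -⟩ :=
    (kummerCoreχ' p).exists_thetaKummerInput_etaleThetaData_prop14iii_ne_one
  exact ⟨ThetaSetting.modelχ'_isEtThOrigin p, T, E, hb, hE ▸ hCC, hη, hne, h14⟩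

end SettingModel

end Literature.AnabelianGeometry.EtaleTheta

end
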